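/-
Copyright: lit-balaban Phase-2 proof seat p02 (gen 12).  Statement-level skeleton of a published paper; no proof claims beyond what
the kernel checks below.
-/
import Literature.MathematicalPhysics.QuantumFieldTheory.BalabanImbrieJaffe1984to88.BIJ88W1Prime543Bound
import Literature.MathematicalPhysics.QuantumFieldTheory.BalabanImbrieJaffe1984to88.BIJ88W1HkPart544Torus
import Literature.MathematicalPhysics.QuantumFieldTheory.BalabanImbrieJaffe1984to88.BIJ88Ineq547W1Prime
import Literature.MathematicalPhysics.QuantumFieldTheory.BalabanImbrieJaffe1984to88.BIJ88SmallCoupling23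

/-!
# `BalabanImbrieJaffe1984to88.BIJ88W1Ineq547Torus` — T. Bałaban, J. Imbrie, A. Jaffe, *Effective action and cluster properties of the
abelian Higgs model*, Commun. Math. Phys. **114** (1988) 257–315 [BalabanImbrieJaffe1988], §5.4 p. 282 [PDF 26]: **«We have put
w₁ = w′₁ + H_k□ − H_{k,loc}, and it satisfies the same bounds as w′₁» ON ALL TORI OF THE SERIES FOR THE KERNELS OF RECORD, AND THE p. 282 BOUNDS
WITH THE PRINTED RADII `r(e_j)` FOR `e_k` SMALL** — r16's typed `Ineq547` inhabited, hypothesis-free with one set of constants over all tori,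
(i) for `w₁` (rows in `□₀`) under the schedule hypotheses of file 2 (`ineq547_w1_allTori`), and (ii) for `w′₁` and `w₁` with the radius schedule
OF THE PAPER `ρ_j = r(e_j) = |log e_j⁻¹|^r`, `e_j = (L^jε)^{(4−d)/2}e` ((2.2)–(2.3), r18's `rSched`), for all sufficiently small `e_k` — the
threshold and the scale gap of file 2 being exactly p08 g4's «e_k small» (`rLen_scale_gap`: `r(e_j) ≥ r(e_k) + (k−j)θ_k`, `θ_k → ∞`).
File 3 of the p02 programme for r16's flip condition of row C2.Eq5.4.7 (file 1 `BIJ88W1Prime543Torus`: `w′₁` and the exact reduction; file 2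
`BIJ88W1Prime543Bound`: the bound for `w′₁`).

statement-level skeleton of published theorems with citation tags; proofs where landed; nothing here is a claim about the Yang–Mills mass gap

PDF held: `paper:balaban1988-cmp114-bij-abelian-higgs-effective-action` (journal page = PDF page + 256).  Page read this session AS AN IMAGE:
p. 282 [PDF 26] (`HOME/lit-balaban-r16/renders/cmp114/original-p026-x2.png`).

CITATION HEADER (lean-in-tree rule).  Part of the lit-balaban TYPED SKELETON (HOME `run/shared/lean/pub/lit-balaban/`), Phase-2 proof seat
p02 (gen 12), unit `lit-balaban-p02`; free-target protocol G.5-34(d), TAKING line HOME/STATUS.md 2026-08-22T02:38Z.  WHAT IS REPRODUCED =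
SKELETON row **C2.Eq5.4.7** (owner r16, referee ref-5), the p. 282 sentence on `w₁`, kind «model instance for the kernels of record».  Decls
used BY NAME (nothing restated): file 2's `ineq547_w1P_allTori`; p02 g8's `BIJ88W1HkPart544Torus.ineq547_w1HkPart_allTori` (the H-part
`H_kχ□ − H_{k,loc}` of `w₁`, entry member, all tori); p08 g4's `BIJ88Ineq547W1Prime.rLen_scale_gap` (the printed scale gap of (2.2)–(2.3)); p36's
`BIJ88SmallCoupling23.tendsto_abs_log_inv` (`|log e_k⁻¹| → ∞`); r18's `rSched`, `eK`, `rLen`; r16's typed `Ineq547`.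

THE PRINTED TEXT (p. 282 [PDF 26], verbatim): *"… ≦ e^{−cr(e_k)}e^{−c dist(p,b′)}, and similarly for w′₁, ∂*w′₁. Also, w′₁ is finite ranged in
the sense that w′₁ = w′₁□; we use w′₁(b,b′) only for b in □₀ ⊂ □. … We have put w₁ = w′₁ + H_k□ − H_{k,loc}, and it satisfies the same bounds as
w′₁."*; p. 260 (2.2) *"e_k = (L^kε)^{(4−d)/2}e"*, (2.3) *"r(e_k) = |log e_k⁻¹|^r, r > 1"*.

WHAT IS PROVED (0 `sorry`, standard axioms; theorems only — proof lane):
* §1 `ineq547_rowWeight` (a row weight `|χ₀| ≤ 1` preserves the shape), **`ineq547_add`** (two (5.4.7)-shapes at the common radius `R` add to one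
  with rate `min(c₁,c₂)/2` once `R ≥ 2log2/min(c₁,c₂)`).
* §2 **`ineq547_w1_allTori`** — `∃ c θ₀ ρ₁ > 0 ∀` torus (`P.d = d`, `P.L = L`) `∀ k ≤ m + K ∀ ρ` (`ρ_k ≥ ρ₁`, gap `θ₀`) `∀ w > 0, c′ ≠ 0 ∀ |χ□| ≤ 1
  ∀ |χ₀| ≤ 1` with the collar clause («b in □₀ ⊂ □»: `χ₀(x) ≠ 0 ∧ dist_k(x,b′) ≤ ρ_k/8 + 2 ⟹ χ□(b′) = 1`):
  `Ineq547 (PBond P 0) (PBond P k) (fun b b′ ↦ χ₀(b₋)·w′₁(b,b′) + χ₀(b₋)·(H_k(b,b′)χ□(b′) − H_{k,loc}(b,b′))) dist_k c (ρ k)`.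
* §3 **`schedule_eventually`** («e_k small»: `ρ₁ ≤ r(e_k)`, `θ₀ ≤ θ_k`, `0 < e_k < 1` eventually as `e_k → 0⁺`), **`ineq547_w1P_allTori_rSched`**
  and **`ineq547_w1_allTori_rSched`** — with the PRINTED radii `rSched L ε e r d` (`ρ_j = r(e_j)`): ONE `c > 0`, and for all `e_k` in a punctured
  right neighbourhood of `0` (uniformly in the torus, `k ≤ m + K`, `ε, e > 0` realizing `e_k`, the weights and cube functions) the shapes
  `Ineq547 … c (r(e_k))` for `w′₁` and for the rows in `□₀` of `w₁`.
HONEST SCOPE.  (i) Entry (value) members only: the output derivatives `∂w₁`, `∂*w₁` need `∂w′₁`, `∂*w′₁` — p08's lane on the interface of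
files 1–2 (stems `BIJ88W1Prime543CurlDiv*` / `BIJ88W1Prime543CurlBound*`); the H-part's `∂`/`∂*` members are p02 g8's `ineq547_w1HkPart3_allTori`.  (ii) `w₁` is typed for the ROWS IN `□₀` (row weight `χ₀` with the collar clause), as the
print uses it («we use w′₁(b,b′) only for b in □₀ ⊂ □»); the H-part needs the collar (`(1 − ζ_k)H_k` is small only beyond `r(e_k)/16` of the row).
(iii) The `e_k`-smallness is an `∀ᶠ … in 𝓝[>] 0` statement (threshold not computed); `d < 4` and `r > 1` as printed (for `d = 4` the printed
`e_k` does not decrease and there is no scale gap).  (iv) `U = 1`, real abelian fields, torus, standing range; constants explicit upstream, not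
optimal.  (v) No `def`, no new named fact; NOT summit progress.  Unit `lit-balaban-p02` (literature-prover-lit-balaban-p02-g12-0), 2026-08-22.
-/

open scoped BigOperators RealInnerProductSpace
open scoped Topology
open Filter

namespace Literature.MathematicalPhysics.QuantumFieldTheory.BalabanImbrieJaffe1984to88.BIJ88W1Ineq547Torus

open Balaban1983to89 hiding Site Plaq
open Balaban1983to89.LatticeFieldCalculus
open BIJ85Prop521Torus BIJ85Prop522Torus BIJ85Sigma422Eta
open BIJ85Sect7Statements BIJ85Ineq722Torus
open BIJ88Sect2Statements (loc eK rLen)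
open BIJ88Sect5StatementsPart2 (Ineq547)
open BIJ88Cutoffs21 (cutoff)
open BIJ88CurlyDkLocTorus (rSched)
open BIJ88W1Prime543Torus (w1P)
open BIJ88W1Prime543Bound (ineq547_w1P_allTori)
open BIJ88W1HkPart544Torus (ineq547_w1HkPart_allTori)
open BIJ88Ineq547W1Prime (rLen_scale_gap)
open BIJ88SmallCoupling23 (tendsto_abs_log_inv)
-- inside this namespace the bare `Site`/`Plaq` are the `ℤ^d` carriers of the QFT root; the torus ones are renamed:
open Balaban1983to89 renaming Site → TSite, Plaq → TPlaq

noncomputable section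

variable {P : Params}

/-! ## §1  Adding two (5.4.7)-shapes -/

/-- a row weight `|χ₀| ≤ 1` preserves the (5.4.7)-shape. [cite: BalabanImbrieJaffe1988, (5.4.7) p.282] -/
theorem ineq547_rowWeight {α β : Type} {f : α → β → ℝ} {dist : α → β → ℝ} {c R : ℝ} (hf : Ineq547 α β f dist c R)
    {χ₀ : α → ℝ} (hχ₀ : ∀ x, |χ₀ x| ≤ 1) : Ineq547 α β (fun x b => χ₀ x * f x b) dist c R := by
  intro x b
  have h := hf x b
  have hpos : 0 ≤ Real.exp (-(c * R)) * Real.exp (-(c * dist x b)) := by positivity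
  calc |χ₀ x * f x b| = |χ₀ x| * |f x b| := abs_mul _ _
    _ ≤ 1 * (Real.exp (-(c * R)) * Real.exp (-(c * dist x b))) := mul_le_mul (hχ₀ x) h (abs_nonneg _) zero_le_one
    _ = _ := one_mul _

/-- **THE SUM OF TWO (5.4.7)-SHAPED KERNELS IS (5.4.7)-SHAPED** (print: *"w₁ = w′₁ + H_k□ − H_{k,loc} … satisfies the same bounds as w′₁"*): rates
`c₁, c₂ > 0` at the common radius `R ≥ 2log2/min(c₁,c₂)` give the rate `min(c₁,c₂)/2` (`2e^{−cR} ≤ e^{−(c/2)R}`).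
[cite: BalabanImbrieJaffe1988, (5.4.7) p.282] -/
theorem ineq547_add {α β : Type} {f g : α → β → ℝ} {dist : α → β → ℝ} (hdist : ∀ x b, 0 ≤ dist x b) {c₁ c₂ R : ℝ}
    (hc₁ : 0 < c₁) (hc₂ : 0 < c₂) (hR : 2 * Real.log 2 / min c₁ c₂ ≤ R)
    (hf : Ineq547 α β f dist c₁ R) (hg : Ineq547 α β g dist c₂ R) :
    Ineq547 α β (fun x b => f x b + g x b) dist (min c₁ c₂ / 2) R := by
  intro x b
  set c := min c₁ c₂ with hc
  have hc0 : 0 < c := lt_min hc₁ hc₂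
  have hD := hdist x b
  have hR0 : 0 ≤ R := le_trans (by positivity) hR
  have hlog : Real.log 2 ≤ c / 2 * R := by
    rw [div_le_iff₀ hc0] at hR; linarith
  have e1 : Real.exp (-(c₁ * R)) * Real.exp (-(c₁ * dist x b)) ≤ Real.exp (-(c * R)) * Real.exp (-(c * dist x b)) :=
    mul_le_mul (Real.exp_le_exp.2 (by nlinarith [min_le_left c₁ c₂])) (Real.exp_le_exp.2 (by nlinarith [min_le_left c₁ c₂]))
      (Real.exp_pos _).le (Real.exp_pos _).le
  have e2 : Real.exp (-(c₂ * R)) * Real.exp (-(c₂ * dist x b)) ≤ Real.exp (-(c * R)) * Real.exp (-(c * dist x b)) :=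
    mul_le_mul (Real.exp_le_exp.2 (by nlinarith [min_le_right c₁ c₂])) (Real.exp_le_exp.2 (by nlinarith [min_le_right c₁ c₂]))
      (Real.exp_pos _).le (Real.exp_pos _).le
  have h2 : (2 : ℝ) * Real.exp (-(c * R)) ≤ Real.exp (-(c / 2 * R)) := by
    calc (2 : ℝ) * Real.exp (-(c * R)) = Real.exp (Real.log 2) * Real.exp (-(c * R)) := by rw [Real.exp_log two_pos]
      _ = Real.exp (Real.log 2 + -(c * R)) := (Real.exp_add _ _).symm
      _ ≤ Real.exp (-(c / 2 * R)) := Real.exp_le_exp.2 (by linarith)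
  have h3 : Real.exp (-(c * dist x b)) ≤ Real.exp (-(c / 2 * dist x b)) := Real.exp_le_exp.2 (by nlinarith)
  calc |f x b + g x b| ≤ |f x b| + |g x b| := abs_add_le _ _
    _ ≤ Real.exp (-(c * R)) * Real.exp (-(c * dist x b)) + Real.exp (-(c * R)) * Real.exp (-(c * dist x b)) :=
        add_le_add ((hf x b).trans e1) ((hg x b).trans e2)
    _ = (2 * Real.exp (-(c * R))) * Real.exp (-(c * dist x b)) := by ring
    _ ≤ Real.exp (-(c / 2 * R)) * Real.exp (-(c / 2 * dist x b)) := mul_le_mul h2 h3 (Real.exp_pos _).le (Real.exp_pos _).le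

/-! ## §2  `w₁ = w′₁ + H_k□ − H_{k,loc}` on all tori -/

/-- **«We have put w₁ = w′₁ + H_k□ − H_{k,loc}, and it satisfies the same bounds as w′₁» ON ALL TORI OF THE SERIES, HYPOTHESIS-FREE**
(`2 ≤ d`, `L` odd `> 1`): ONE `(c, θ₀, ρ₁)` such that for every torus (`P.d = d`, `P.L = L`), every `k ≤ m + K`, every radius schedule `ρ`
with `ρ_k ≥ ρ₁` and scale gap `ρ_j ≥ ρ_k + (k−j)θ₀`, all weights `w > 0`, `c′ ≠ 0` of p11's `HkE` (immaterial to its kernel), every cube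
function `|χ□| ≤ 1` and every row weight `|χ₀| ≤ 1` carrying the collar clause «b in □₀ ⊂ □» (`χ₀(x) ≠ 0 ∧ dist_k(x,b′) ≤ ρ_k/8 + 2 ⟹ χ□(b′) = 1`),
r16's typed shape holds for the ROWS IN `□₀` of `w₁`:
`Ineq547 (T_η-bonds) (T₁^{(k)}-bonds) (χ₀·(w′₁ + H_kχ□ − H_{k,loc})) dist_k c ρ_k` — file 2's `ineq547_w1P_allTori` + p02 g8's
`ineq547_w1HkPart_allTori` (the H-part, cutoff radii `(ρ_k/16, ρ_k/8)`) + `ineq547_add`. [cite: BalabanImbrieJaffe1988, (5.4.7) p.282] -/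
theorem ineq547_w1_allTori {d L : ℕ} (hd : 2 ≤ d) (hL : Odd L ∧ 1 < L) :
    ∃ c θ₀ ρ₁ : ℝ, 0 < c ∧ 0 < θ₀ ∧ 0 < ρ₁ ∧ ∀ (P : Params) (hPd : P.d = d) (_ : P.L = L) (k : ℕ) (_ : k ≤ P.m + P.K) (ρ : ℕ → ℝ),
      ρ₁ ≤ ρ k → (∀ j < k, ρ k + ((k - j : ℕ) : ℝ) * θ₀ ≤ ρ j) →
      ∀ (c' : ℝ), c' ≠ 0 → ∀ (w : ℝ), 0 < w → ∀ (χb : PBond P k → ℝ), (∀ b', |χb b'| ≤ 1) →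
      ∀ (χ₀ : TSite P 0 → ℝ), (∀ x, |χ₀ x| ≤ 1) →
      (∀ (x : TSite P 0) (b' : PBond P k), χ₀ x ≠ 0 → distEU P k x b'.src ≤ ρ k / 8 + 2 → χb b' = 1) →
        Ineq547 (PBond P 0) (PBond P k)
          (fun b b' => χ₀ b.src * w1P (hPd ▸ hd) ρ k χb b b' +
            χ₀ b.src * (WithLp.ofLp (HkE P w c' k (toEj P k (Pi.single b' 1))) b * χb b' -
              loc (cutoff (ρ k / 16) (ρ k / 8) (fun (b : PBond P 0) (b' : PBond P k) => distEU P k b.src b'.src))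
                (fun b b'' => WithLp.ofLp (HkE P w c' k (toEj P k (Pi.single b'' 1))) b) b b'))
          (fun b b' => distEU P k b.src b'.src) c (ρ k) := by
  obtain ⟨ca, θ₀, ρ₁, hca, hθ₀, hρ₁, hA⟩ := ineq547_w1P_allTori hd hL
  obtain ⟨cb, r₁, hcb, hB⟩ := ineq547_w1HkPart_allTori (d := d) (L := L) (le_trans one_le_two hd) hL one_pos
  refine ⟨min ca cb / 2, θ₀, max ρ₁ (max r₁ (2 * Real.log 2 / min ca cb)), half_pos (lt_min hca hcb), hθ₀,
    lt_of_lt_of_le hρ₁ (le_max_left _ _), fun P hPd hPL k hk ρ hρk hgap c' hc' w hw χb hχb χ₀ hχ₀ hcollar => ?_⟩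
  have h1 := hA P hPd hPL k hk ρ ((le_max_left _ _).trans hρk) hgap χb hχb
  have h2 := (hB P hPd hPL k hk c' hc' w hw (ρ k) ((le_max_left _ _).trans ((le_max_right _ _).trans hρk)) χb hχb χ₀ hχ₀ hcollar).1
  have hR : 2 * Real.log 2 / min ca cb ≤ ρ k := (le_max_right _ _).trans ((le_max_right _ _).trans hρk)
  exact ineq547_add (fun b b' => div_nonneg (Nat.cast_nonneg _) (pow_pos P.cast_L_pos k).le) hca hcb hR
    (ineq547_rowWeight h1 fun b => hχ₀ b.src) h2


/-! ## §3  The printed radii `ρ_j = r(e_j)` ((2.2)–(2.3)) satisfy the schedule hypotheses for `e_k` small -/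

/-- **«e_k small»**: for the printed scales `r(e_k) = |log e_k⁻¹|^r`, `r > 1`, and `θ_k = r(log e_k⁻¹)^{r−1}·((4−d)/2)log L` (`d < 4`, `L > 1`;
p08 g4's gap constant), every threshold is eventually met as `e_k → 0⁺`: `ρ₁ ≤ r(e_k)`, `θ₀ ≤ θ_k`, and `0 < e_k < 1` (p36's
`tendsto_abs_log_inv`). [cite: BalabanImbrieJaffe1988, (2.3) p.260] -/
theorem schedule_eventually {d : ℕ} (hd4 : d < 4) {Lr : ℝ} (hLr : 1 < Lr) {r : ℝ} (hr : 1 < r) (ρ₁ θ₀ : ℝ) :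
    ∀ᶠ ek in 𝓝[>] (0 : ℝ), ρ₁ ≤ rLen r ek ∧ θ₀ ≤ r * Real.log ek⁻¹ ^ (r - 1) * (((4 - (d : ℝ)) / 2) * Real.log Lr) ∧
      0 < ek ∧ ek < 1 := by
  have hd' : (d : ℝ) < 4 := by exact_mod_cast hd4
  have hκ : 0 < ((4 - (d : ℝ)) / 2) * Real.log Lr := mul_pos (by linarith) (Real.log_pos hLr)
  have hr0 : 0 < r := by linarith
  have hr1 : 0 < r - 1 := by linarith
  -- `r(e_k) → ∞`
  have h1 : ∀ᶠ ek : ℝ in 𝓝[>] 0, ρ₁ ≤ rLen r ek := by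
    have ht : Tendsto (fun ek : ℝ => rLen r ek) (𝓝[>] 0) atTop := (tendsto_rpow_atTop hr0).comp tendsto_abs_log_inv
    exact ht.eventually (eventually_ge_atTop ρ₁)
  -- `|log e_k⁻¹|^{r−1} → ∞`
  have h2 : ∀ᶠ ek : ℝ in 𝓝[>] 0, θ₀ / (r * (((4 - (d : ℝ)) / 2) * Real.log Lr)) ≤ |Real.log ek⁻¹| ^ (r - 1) := by
    have ht : Tendsto (fun ek : ℝ => |Real.log ek⁻¹| ^ (r - 1)) (𝓝[>] 0) atTop := (tendsto_rpow_atTop hr1).comp tendsto_abs_log_inv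
    exact ht.eventually (eventually_ge_atTop _)
  -- `0 < e_k < 1`
  have h3 : ∀ᶠ ek : ℝ in 𝓝[>] 0, 0 < ek := eventually_mem_nhdsWithin
  have h4 : ∀ᶠ ek : ℝ in 𝓝[>] 0, ek < 1 := eventually_nhdsWithin_of_eventually_nhds (eventually_lt_nhds one_pos)
  filter_upwards [h1, h2, h3, h4] with ek e1 e2 e3 e4
  have hlog : 0 ≤ Real.log ek⁻¹ := Real.log_nonneg ((one_le_inv₀ e3).2 e4.le)
  rw [abs_of_nonneg hlog] at e2
  refine ⟨e1, ?_, e3, e4⟩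
  have hrk : 0 < r * (((4 - (d : ℝ)) / 2) * Real.log Lr) := mul_pos hr0 hκ
  rw [div_le_iff₀ hrk] at e2
  calc θ₀ ≤ Real.log ek⁻¹ ^ (r - 1) * (r * (((4 - (d : ℝ)) / 2) * Real.log Lr)) := e2
    _ = _ := by ring

/-- **(5.4.7)-SHAPE FOR `w′₁` WITH THE PRINTED RADII, ALL TORI, `e_k` SMALL** (`2 ≤ d < 4`, `L` odd `> 1`, `r > 1`): with the radius schedule of
the paper `ρ_j = r(e_j)` (r18's `rSched`, (2.2)–(2.3): `e_j = (L^jε)^{(4−d)/2}e`), there is ONE `c > 0` such that for all sufficiently small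
`e_k > 0` (a punctured right neighbourhood of `0`, uniform in the torus, in `k ≤ m + K`, in `ε, e > 0` realizing `e_k`, and in `|χ| ≤ 1`),
`|w′₁(b, b′)| ≤ e^{−c·r(e_k)}e^{−c·dist_k(b₋,b′₋)}` — the threshold and the scale gap of `ineq547_w1P_allTori` being supplied by p08 g4's
`rLen_scale_gap` and `schedule_eventually`. [cite: BalabanImbrieJaffe1988, (5.4.7) p.282] -/
theorem ineq547_w1P_allTori_rSched {d L : ℕ} (hd : 2 ≤ d) (hd4 : d < 4) (hL : Odd L ∧ 1 < L) {r : ℝ} (hr : 1 < r) :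
    ∃ c : ℝ, 0 < c ∧ ∀ᶠ ek in 𝓝[>] (0 : ℝ), ∀ (P : Params) (hPd : P.d = d) (_ : P.L = L) (k : ℕ) (_ : k ≤ P.m + P.K) (ε e : ℝ),
      0 < ε → 0 < e → eK (L : ℝ) ε e d k = ek → ∀ (χ : PBond P k → ℝ), (∀ b', |χ b'| ≤ 1) →
        Ineq547 (PBond P 0) (PBond P k) (w1P (hPd ▸ hd) (rSched (L : ℝ) ε e r d) k χ) (fun b b' => distEU P k b.src b'.src) c
          (rSched (L : ℝ) ε e r d k) := by
  obtain ⟨c, θ₀, ρ₁, hc, hθ₀, hρ₁, hA⟩ := ineq547_w1P_allTori hd hL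
  have hL1 : (1 : ℝ) < (L : ℝ) := by exact_mod_cast hL.2
  refine ⟨c, hc, ?_⟩
  filter_upwards [schedule_eventually hd4 hL1 hr ρ₁ θ₀] with ek hek
  obtain ⟨hρ, hθ, hek0, hek1⟩ := hek
  intro P hPd hPL k hk ε e hε he hekk χ hχ
  refine hA P hPd hPL k hk (rSched (L : ℝ) ε e r d) ?_ ?_ χ hχ
  · show ρ₁ ≤ rLen r (eK (L : ℝ) ε e d k)
    rwa [hekk]
  · intro j hj
    show rLen r (eK (L : ℝ) ε e d k) + ((k - j : ℕ) : ℝ) * θ₀ ≤ rLen r (eK (L : ℝ) ε e d j)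
    have hgap := rLen_scale_gap hL1.le hε he hr.le (show d ≤ 4 by omega) (k := k) (by rw [hekk]; exact hek1) (by rw [hekk]; exact hek0)
      (k - j) j (by omega)
    rw [hekk] at hgap ⊢
    have hm : 0 ≤ ((k - j : ℕ) : ℝ) := Nat.cast_nonneg _
    nlinarith [mul_le_mul_of_nonneg_left hθ hm]


/-- **(5.4.7)-SHAPE FOR `w₁ = w′₁ + H_k□ − H_{k,loc}` WITH THE PRINTED RADII, ALL TORI, `e_k` SMALL** (`2 ≤ d < 4`, `L` odd `> 1`, `r > 1`):
ONE `c > 0` such that for all sufficiently small `e_k > 0` (uniformly in the torus, `k ≤ m + K`, `ε, e > 0` realizing `e_k`, the weights of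
`HkE`, the cube function `|χ□| ≤ 1` and the row weight `|χ₀| ≤ 1` with the collar clause at radius `r(e_k)/8 + 2`), the rows in `□₀` of `w₁`
obey `|w₁(b, b′)| ≤ e^{−c·r(e_k)}e^{−c·dist_k(b₋,b′₋)}` — print's *"it satisfies the same bounds as w′₁"*. [cite: BalabanImbrieJaffe1988, (5.4.7) p.282] -/
theorem ineq547_w1_allTori_rSched {d L : ℕ} (hd : 2 ≤ d) (hd4 : d < 4) (hL : Odd L ∧ 1 < L) {r : ℝ} (hr : 1 < r) :
    ∃ c : ℝ, 0 < c ∧ ∀ᶠ ek in 𝓝[>] (0 : ℝ), ∀ (P : Params) (hPd : P.d = d) (_ : P.L = L) (k : ℕ) (_ : k ≤ P.m + P.K) (ε e : ℝ),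
      0 < ε → 0 < e → eK (L : ℝ) ε e d k = ek →
      ∀ (c' : ℝ), c' ≠ 0 → ∀ (w : ℝ), 0 < w → ∀ (χb : PBond P k → ℝ), (∀ b', |χb b'| ≤ 1) →
      ∀ (χ₀ : TSite P 0 → ℝ), (∀ x, |χ₀ x| ≤ 1) →
      (∀ (x : TSite P 0) (b' : PBond P k), χ₀ x ≠ 0 → distEU P k x b'.src ≤ rSched (L : ℝ) ε e r d k / 8 + 2 → χb b' = 1) →
        Ineq547 (PBond P 0) (PBond P k)
          (fun b b' => χ₀ b.src * w1P (hPd ▸ hd) (rSched (L : ℝ) ε e r d) k χb b b' +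
            χ₀ b.src * (WithLp.ofLp (HkE P w c' k (toEj P k (Pi.single b' 1))) b * χb b' -
              loc (cutoff (rSched (L : ℝ) ε e r d k / 16) (rSched (L : ℝ) ε e r d k / 8)
                  (fun (b : PBond P 0) (b' : PBond P k) => distEU P k b.src b'.src))
                (fun b b'' => WithLp.ofLp (HkE P w c' k (toEj P k (Pi.single b'' 1))) b) b b'))
          (fun b b' => distEU P k b.src b'.src) c (rSched (L : ℝ) ε e r d k) := by
  obtain ⟨c, θ₀, ρ₁, hc, hθ₀, hρ₁, hA⟩ := ineq547_w1_allTori hd hL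
  have hL1 : (1 : ℝ) < (L : ℝ) := by exact_mod_cast hL.2
  refine ⟨c, hc, ?_⟩
  filter_upwards [schedule_eventually hd4 hL1 hr ρ₁ θ₀] with ek hek
  obtain ⟨hρ, hθ, hek0, hek1⟩ := hek
  intro P hPd hPL k hk ε e hε he hekk c' hc' w hw χb hχb χ₀ hχ₀ hcollar
  refine hA P hPd hPL k hk (rSched (L : ℝ) ε e r d) ?_ ?_ c' hc' w hw χb hχb χ₀ hχ₀ hcollar
  · show ρ₁ ≤ rLen r (eK (L : ℝ) ε e d k)
    rwa [hekk]
  · intro j hj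
    show rLen r (eK (L : ℝ) ε e d k) + ((k - j : ℕ) : ℝ) * θ₀ ≤ rLen r (eK (L : ℝ) ε e d j)
    have hgap := rLen_scale_gap hL1.le hε he hr.le (show d ≤ 4 by omega) (k := k) (by rw [hekk]; exact hek1) (by rw [hekk]; exact hek0)
      (k - j) j (by omega)
    rw [hekk] at hgap ⊢
    have hm : 0 ≤ ((k - j : ℕ) : ℝ) := Nat.cast_nonneg _
    nlinarith [mul_le_mul_of_nonneg_left hθ hm]

end

end Literature.MathematicalPhysics.QuantumFieldTheory.BalabanImbrieJaffe1984to88.BIJ88W1Ineq547Torus
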